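import Mathlib
import Literature.Computability.Complexity.FixedDimILPRounding
import Literature.Computability.Complexity.FixedDimILPWidth
import HarnessLib

/-!
# Lenstra's algorithm in fixed dimension, VI: the rounding map in integer coordinates

Topic `Computability/Complexity`, grouping namespace `FixedDimILP`; joins file II (barycentric
coordinates `bary p x` of a maximal-volume tuple `p₀, …, p_N`, the chart `affineOf`) and file III (the
lattice picture `linComb B₀ x = Σ xᵢ b⁰ᵢ`). The machine holds the chosen vertices as integer numerators
`Pᵢ` over a common denominator `D` (`pᵢ = Pᵢ / D`), forms the integer edge matrix `W̃` (rows
`Pᵢ₊₁ - P₀`), an integer quasi-inverse `G` with `W̃ G = Δ₂ • 1` (tree: `GSInverse.invMatrix`, `Δ₂ = det²`),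
and the lattice basis `B₀ = (N+1) D • G`, shift `s = (N+1) • (P₀ G)` and target `t = Δ₂ 𝟙 + s`. With
`K = (N+1) Δ₂` the rounding map `τ(x) = (bary₁(x), …, bary_N(x))` (so that `τ(pᵢ₊₁) = eᵢ`, `τ(p₀) = 0`)
satisfies `Σ xᵢ b⁰ᵢ = K τ(x) + s` and `Σ xᵢ b⁰ᵢ - t = K (τ(x) - g)`, `g` the centroid `(1/(N+1), …)`.
Everything the lattice step needs is derived here:

* `edge p` / `edgeInt P`, `det_homMat_eq_det_edge` (`det H(p) = det (pᵢ₊₁ - p₀)ᵢ`), `pts P D`,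
  `det_homMat_pts` (`det H = det W̃ / D^N`); `tauV`, `affineOf_tauV`, `tauV_vecMul_edge`;
* `latB₀`, `shiftS`, `target`, `smul_tauV_eq_vecMul` (`Δ₂ τ = (D(x - p₀)) G`), **`linComb_latB₀_sub_target`** (`(Σ xᵢ b⁰ᵢ)ⱼ - tⱼ = K (τ(x)ⱼ - 1/(N+1))`),
  `det_latB₀_ne_zero`;
* norms: `norm_le_sqrt_mul` (a coordinate bound gives `‖v‖ ≤ √N M`; the converse `|vⱼ| ≤ ‖v‖` is the
  tree's `SimApproxLLL.abs_apply_le_norm'` / Mathlib `PiLp.norm_apply_le`) — and the two consequences: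
  **`residual_radius_lt_of_not_mem`** (an `x` outside a polyhedron containing the `pᵢ` has
  `‖Σ xᵢ b⁰ᵢ - t‖ > K/(N+1)²`) and **`norm_linComb_sub_target_le`** (an `x` with all `|baryᵢ x| ≤ 1` has
  `‖Σ xᵢ b⁰ᵢ - t‖ ≤ 2 K (N+1)`).

## References

* H. W. Lenstra, Jr., *Integer programming with a fixed number of variables*, Math. Oper. Res. 8 (1983)
  538–548, §1 ((2): `B(p, r) ⊂ τK ⊂ B(p, R)`), §2 (the simplex and `τ`). [LenstraHW1983]
* A. Schrijver, *Theory of Linear and Integer Programming*, Wiley 1986, Thm. 18.7 (proof). [Schrijver1986]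
-/

noncomputable section

namespace Literature.Computability.Complexity

namespace FixedDimILP

open Matrix Finset Literature.Algebra.EuclideanLattices

variable {N : ℕ}

/-! ### The edge matrix and the volume -/

/-- The EDGE MATRIX of a tuple: rows `pᵢ₊₁ - p₀`. [cite: LenstraHW1983, §2] -/
def edge (p : Fin (N + 1) → Fin N → ℝ) : Matrix (Fin N) (Fin N) ℝ := Matrix.of fun i j => p i.succ j - p 0 j

/-- **`det H(p) = det (edge p)`**: subtract the first row `(1, p₀)` from the others and expand along the
first column. [folklore] -/
theorem det_homMat_eq_det_edge (p : Fin (N + 1) → Fin N → ℝ) : (homMat p).det = (edge p).det := by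
  -- the row-reduced matrix
  let H' : Matrix (Fin (N + 1)) (Fin (N + 1)) ℝ :=
    Matrix.of (Fin.cases (hom (p 0)) fun i => Fin.cons 0 (fun j => p i.succ j - p 0 j))
  have hred : (homMat p).det = H'.det := by
    refine det_eq_of_forall_row_eq_smul_add_const (Fin.cases 0 fun _ => 1) 0 rfl fun i j => ?_
    refine Fin.cases ?_ (fun i' => ?_) i
    · simp [H', homMat]
    · refine Fin.cases ?_ (fun j' => ?_) j
      · simp [H', homMat, hom]
      · simp [H', homMat, hom]
  rw [hred, det_succ_column_zero, Fin.sum_univ_succ]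
  have hzero : ∀ i : Fin N, H' i.succ 0 = 0 := fun i => by simp [H']
  have h00 : H' 0 0 = 1 := by simp [H', hom]
  have hsub : H'.submatrix Fin.succ Fin.succ = edge p := by
    ext i j; simp [H', edge]
  simp [hzero, h00, hsub]

/-! ### Rational points over a common denominator -/

/-- The real points `Pᵢ / D` of integer numerators over a common denominator. [folklore] -/
def pts (P : Fin (N + 1) → Fin N → ℤ) (D : ℕ) : Fin (N + 1) → Fin N → ℝ := fun i j => (P i j : ℝ) / D

/-- The INTEGER edge matrix `W̃`: rows `Pᵢ₊₁ - P₀`. [cite: LenstraHW1983, §2] -/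
def edgeInt (P : Fin (N + 1) → Fin N → ℤ) : Matrix (Fin N) (Fin N) ℤ := Matrix.of fun i j => P i.succ j - P 0 j

/-- `edge (P / D) = W̃ / D`. [folklore] -/
theorem edge_pts (P : Fin (N + 1) → Fin N → ℤ) (D : ℕ) :
    edge (pts P D) = ((D : ℝ)⁻¹) • (edgeInt P).map (Int.cast : ℤ → ℝ) := by
  ext i j
  simp [edge, pts, edgeInt, Matrix.map_apply, div_eq_inv_mul, mul_sub]

/-- **`det H(P/D) = det W̃ / D^N`**; in particular `det H ≠ 0 ↔ det W̃ ≠ 0`. [folklore] -/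
theorem det_homMat_pts (P : Fin (N + 1) → Fin N → ℤ) (D : ℕ) :
    (homMat (pts P D)).det = ((edgeInt P).det : ℝ) / (D : ℝ) ^ N := by
  rw [det_homMat_eq_det_edge, edge_pts P D, det_smul, Fintype.card_fin,
    show ((edgeInt P).map (Int.cast : ℤ → ℝ)) = (Int.castRingHom ℝ).mapMatrix (edgeInt P) from rfl,
    ← RingHom.map_det, eq_intCast, inv_pow, div_eq_inv_mul]

/-- Nonsingularity transfers: `det W̃ ≠ 0 → det H(P/D) ≠ 0`. [folklore] -/
theorem det_homMat_pts_ne_zero {P : Fin (N + 1) → Fin N → ℤ} {D : ℕ} (hD : 0 < D) (h : (edgeInt P).det ≠ 0) :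
    (homMat (pts P D)).det ≠ 0 := by
  rw [det_homMat_pts P D]
  exact div_ne_zero (Int.cast_ne_zero.2 h) (pow_ne_zero _ (Nat.cast_ne_zero.2 hD.ne'))

/-! ### The rounding map `τ` -/

/-- The ROUNDING MAP `τ(x) = (bary₁ x, …, bary_N x)`: affine, `τ(p₀) = 0`, `τ(pᵢ₊₁) = eᵢ`.
[cite: LenstraHW1983, §1–§2 (the transformation `τ`)] -/
def tauV (p : Fin (N + 1) → Fin N → ℝ) (x : Fin N → ℝ) : Fin N → ℝ := fun j => bary p x j.succ

/-- **`x = affineOf p (τ x)`**: the chart inverts the rounding map. [folklore] -/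
theorem affineOf_tauV {p : Fin (N + 1) → Fin N → ℝ} (hp : (homMat p).det ≠ 0) (x : Fin N → ℝ) :
    affineOf p (tauV p x) = x := by
  rw [affineOf_eq_sum]
  have h0 : (1 - ∑ j, tauV p x j) = bary p x 0 := by
    have := sum_bary hp x
    rw [Fin.sum_univ_succ] at this
    simp only [tauV]; linarith
  conv_rhs => rw [eq_sum_bary_smul hp x]
  refine Finset.sum_congr rfl fun i _ => ?_
  congr 1
  refine Fin.cases ?_ (fun j => ?_) i
  · rw [Fin.cons_zero, h0]
  · rw [Fin.cons_succ]; rfl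

/-- `τ(x) · edge = x - p₀`. [folklore] -/
theorem tauV_vecMul_edge {p : Fin (N + 1) → Fin N → ℝ} (hp : (homMat p).det ≠ 0) (x : Fin N → ℝ) :
    tauV p x ᵥ* edge p = x - p 0 := by
  have h := affineOf_tauV hp x
  rw [affineOf] at h
  have h' : ∑ i, tauV p x i • (p i.succ - p 0) = x - p 0 := eq_sub_of_add_eq' h
  rw [← h', vecMul_eq_sum]
  rfl

/-! ### The lattice data and the key identity -/

/-- The lattice basis `B₀ = (N+1) D • G` (rows). [cite: LenstraHW1983, §1 (the lattice `τℤⁿ`)] -/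
def latB₀ (N : ℕ) (D : ℕ) (G : Matrix (Fin N) (Fin N) ℤ) : Matrix (Fin N) (Fin N) ℤ := (((N : ℤ) + 1) * D) • G

/-- The shift `s = (N+1) • (P₀ ᵥ* G)`. [folklore] -/
def shiftS (P : Fin (N + 1) → Fin N → ℤ) (G : Matrix (Fin N) (Fin N) ℤ) : Fin N → ℤ := ((N : ℤ) + 1) • (P 0 ᵥ* G)

/-- The integer target `t = Δ₂ 𝟙 + s` (`= K g + s`, `g` the centroid, `K = (N+1)Δ₂`). [folklore] -/
def target (P : Fin (N + 1) → Fin N → ℤ) (G : Matrix (Fin N) (Fin N) ℤ) (Δ₂ : ℤ) : Fin N → ℤ :=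
  fun k => Δ₂ + shiftS P G k

/-- **`Δ₂ • τ(x) = (D (x - p₀)) G`** (`W̃ G = Δ₂ • 1`): the rounding coordinates with integers only —
for `x = p/d` this reads `Δ₂ d τ(x) = (D p - d P₀) G`, the machine's `baryNum`. [cite: LenstraHW1983, §2] -/
theorem smul_tauV_eq_vecMul {P : Fin (N + 1) → Fin N → ℤ} {D : ℕ} (hD : 0 < D) {G : Matrix (Fin N) (Fin N) ℤ}
    {Δ₂ : ℤ} (hG : edgeInt P * G = Δ₂ • (1 : Matrix (Fin N) (Fin N) ℤ)) (hW : (edgeInt P).det ≠ 0)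
    (x : Fin N → ℝ) :
    (Δ₂ : ℝ) • tauV (pts P D) x = ((D : ℝ) • (x - pts P D 0)) ᵥ* G.map (Int.cast : ℤ → ℝ) := by
  have hp := det_homMat_pts_ne_zero hD hW
  -- `τ ᵥ* W̃ = D (x - p₀)` (real)
  have h1 : tauV (pts P D) x ᵥ* (edgeInt P).map (Int.cast : ℤ → ℝ) = (D : ℝ) • (x - pts P D 0) := by
    have h := tauV_vecMul_edge hp x
    rw [edge_pts P D, vecMul_smul] at h
    rw [← h, smul_smul, mul_inv_cancel₀ (Nat.cast_ne_zero.2 hD.ne'), one_smul]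
  -- multiply by `G`
  have hGR : (edgeInt P).map (Int.cast : ℤ → ℝ) * G.map (Int.cast : ℤ → ℝ) = (Δ₂ : ℝ) • (1 : Matrix (Fin N) (Fin N) ℝ) := by
    rw [show (edgeInt P).map (Int.cast : ℤ → ℝ) * G.map (Int.cast : ℤ → ℝ) = (edgeInt P * G).map (Int.cast : ℤ → ℝ)
      from (Matrix.map_mul (f := Int.castRingHom ℝ)).symm, hG]
    ext i k
    rw [Matrix.map_apply, Matrix.smul_apply, Matrix.smul_apply, Matrix.one_apply, Matrix.one_apply]
    split_ifs <;> simp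
  rw [← h1, vecMul_vecMul, hGR, vecMul_smul, vecMul_one]

/-- **The key identity**: if `W̃ G = Δ₂ • 1` then `(Σ xᵢ b⁰ᵢ)ⱼ = K τ(x)ⱼ + sⱼ`, `K = (N+1)Δ₂`.
[cite: LenstraHW1983, §1–§2 (the lattice `L = τℤⁿ`)] -/
theorem linComb_latB₀ {P : Fin (N + 1) → Fin N → ℤ} {D : ℕ} (hD : 0 < D) {G : Matrix (Fin N) (Fin N) ℤ}
    {Δ₂ : ℤ} (hG : edgeInt P * G = Δ₂ • (1 : Matrix (Fin N) (Fin N) ℤ)) (hW : (edgeInt P).det ≠ 0)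
    (x : Fin N → ℝ) (j : Fin N) :
    linComb (latB₀ N D G) x j = (((N : ℝ) + 1) * Δ₂) * tauV (pts P D) x j + (shiftS P G j : ℝ) := by
  have h3 := congrFun (smul_tauV_eq_vecMul hD hG hW x) j
  simp only [Pi.smul_apply, smul_eq_mul] at h3
  -- unfold both sides in coordinates
  rw [linComb_apply]
  simp only [latB₀, shiftS, Matrix.smul_apply, smul_eq_mul, Pi.smul_apply, Int.cast_mul, Int.cast_add,
    Int.cast_natCast, Int.cast_one]
  rw [show (((N : ℝ) + 1) * Δ₂) * tauV (pts P D) x j = ((N : ℝ) + 1) * ((Δ₂ : ℝ) * tauV (pts P D) x j) by ring, h3]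
  simp only [vecMul, dotProduct, Matrix.map_apply, Pi.smul_apply, Pi.sub_apply, smul_eq_mul, pts,
    Int.cast_sum, Int.cast_mul, Finset.mul_sum]
  have hD' : (D : ℝ) ≠ 0 := Nat.cast_ne_zero.2 hD.ne'
  rw [← Finset.sum_add_distrib]
  refine Finset.sum_congr rfl fun i _ => ?_
  field_simp
  ring

/-- **`(Σ xᵢ b⁰ᵢ)ⱼ - tⱼ = K (τ(x)ⱼ - 1/(N+1))`**: the lattice picture of `τ(x) - g`.
[cite: LenstraHW1983, §1 ((2), centred at `p = τ`-centroid)] -/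
theorem linComb_latB₀_sub_target {P : Fin (N + 1) → Fin N → ℤ} {D : ℕ} (hD : 0 < D) {G : Matrix (Fin N) (Fin N) ℤ}
    {Δ₂ : ℤ} (hG : edgeInt P * G = Δ₂ • (1 : Matrix (Fin N) (Fin N) ℤ)) (hW : (edgeInt P).det ≠ 0)
    (x : Fin N → ℝ) (j : Fin N) :
    linComb (latB₀ N D G) x j - (target P G Δ₂ j : ℝ) =
      (((N : ℝ) + 1) * Δ₂) * (tauV (pts P D) x j - 1 / ((N : ℝ) + 1)) := by
  rw [linComb_latB₀ hD hG hW x j, target]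
  push_cast
  have : (N : ℝ) + 1 ≠ 0 := by positivity
  field_simp
  ring

/-- `B₀` is nonsingular (`W̃ G = Δ₂ • 1`, `Δ₂ ≠ 0`, `D > 0`). [folklore] -/
theorem det_latB₀_ne_zero {P : Fin (N + 1) → Fin N → ℤ} {D : ℕ} (hD : 0 < D) {G : Matrix (Fin N) (Fin N) ℤ}
    {Δ₂ : ℤ} (hΔ : Δ₂ ≠ 0) (hG : edgeInt P * G = Δ₂ • (1 : Matrix (Fin N) (Fin N) ℤ)) :
    (latB₀ N D G).det ≠ 0 := by
  have hdetG : G.det ≠ 0 := by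
    intro h0
    have := congrArg Matrix.det hG
    rw [det_mul, h0, mul_zero, det_smul, det_one, mul_one, Fintype.card_fin] at this
    exact pow_ne_zero _ hΔ this.symm
  rw [latB₀, det_smul, Fintype.card_fin]
  refine mul_ne_zero (pow_ne_zero _ (mul_ne_zero ?_ (Nat.cast_ne_zero.2 hD.ne'))) hdetG
  exact_mod_cast Nat.succ_ne_zero N

/-! ### Norms: coordinates versus the Euclidean norm -/

/-- Coordinate bounds give `‖v‖ ≤ √N · M`. [folklore] -/
theorem norm_le_sqrt_mul (v : EuclideanSpace ℝ (Fin N)) {M : ℝ} (hM : 0 ≤ M) (h : ∀ j, |v j| ≤ M) :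
    ‖v‖ ≤ Real.sqrt N * M := by
  have hsq : ‖v‖ ^ 2 ≤ (Real.sqrt N * M) ^ 2 := by
    rw [EuclideanSpace.norm_sq_eq, mul_pow, Real.sq_sqrt (Nat.cast_nonneg N)]
    calc ∑ j, ‖v j‖ ^ 2 ≤ ∑ _j : Fin N, M ^ 2 := Finset.sum_le_sum fun j _ => by
            rw [Real.norm_eq_abs]; exact pow_le_pow_left₀ (abs_nonneg _) (h j) 2
      _ = N * M ^ 2 := by rw [Finset.sum_const, Finset.card_univ, Fintype.card_fin, nsmul_eq_mul]
  exact (sq_le_sq₀ (norm_nonneg _) (by positivity)).1 hsq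

/-- The real vector of an integer vector, in `ℝ^N` (Euclidean). [folklore] -/
def realVec (v : Fin N → ℤ) : EuclideanSpace ℝ (Fin N) := intVecToEuclidean N v

/-- Coordinates of `realVec`. [folklore] -/
@[simp] theorem realVec_apply (v : Fin N → ℤ) (j : Fin N) : realVec v j = (v j : ℝ) :=
  intVecToEuclidean_apply N v j

/-! ### The two consequences used by the recursion -/

/-- **A point outside the polytope is far from the centre in the lattice picture.** If the vertices
`pᵢ = Pᵢ/D` lie in `poly sys` but `x ∉ poly sys`, then some rounding coordinate of `x` is more than
`1/(N+1)²` from `1/(N+1)` (else `x = affineOf p (τ x)` would be a convex combination of the `pᵢ`), hence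
`‖Σ xᵢ b⁰ᵢ - t‖ > K / (N+1)²`. Applied to Babai's point this is the dichotomy "either an integer point is
found or the residual is large". [cite: LenstraHW1983, §1 (first case: `y ∈ τK`)] -/
theorem residual_radius_lt_of_not_mem {sys : RealSys N} {P : Fin (N + 1) → Fin N → ℤ} {D : ℕ} (hD : 0 < D)
    {G : Matrix (Fin N) (Fin N) ℤ} {Δ₂ : ℤ} (hΔ : 0 < Δ₂)
    (hG : edgeInt P * G = Δ₂ • (1 : Matrix (Fin N) (Fin N) ℤ)) (hW : (edgeInt P).det ≠ 0)
    (hpi : ∀ i, pts P D i ∈ poly sys) {x : Fin N → ℝ} (hx : x ∉ poly sys) :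
    (((N : ℝ) + 1) * Δ₂) / ((N : ℝ) + 1) ^ 2 < ‖linComb (latB₀ N D G) x - realVec (target P G Δ₂)‖ := by
  have hp := det_homMat_pts_ne_zero hD hW
  -- some coordinate of `τ x` is far from `1/(N+1)`
  have hfar : ∃ j, 1 / ((N : ℝ) + 1) ^ 2 < |tauV (pts P D) x j - 1 / ((N : ℝ) + 1)| := by
    by_contra h
    push Not at h
    obtain ⟨hnn, hsum⟩ := stdSimplex_of_near_centroid (N := N) (y := tauV (pts P D) x) h
    exact hx (affineOf_tauV hp x ▸ affineOf_mem_poly hp hpi hnn hsum)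
  obtain ⟨j, hj⟩ := hfar
  have hK : (0 : ℝ) < ((N : ℝ) + 1) * Δ₂ := by positivity
  calc (((N : ℝ) + 1) * Δ₂) / ((N : ℝ) + 1) ^ 2 = (((N : ℝ) + 1) * Δ₂) * (1 / ((N : ℝ) + 1) ^ 2) := by ring
    _ < (((N : ℝ) + 1) * Δ₂) * |tauV (pts P D) x j - 1 / ((N : ℝ) + 1)| := mul_lt_mul_of_pos_left hj hK
    _ = |linComb (latB₀ N D G) x j - (target P G Δ₂ j : ℝ)| := by
        rw [linComb_latB₀_sub_target hD hG hW x j, abs_mul, abs_of_pos hK]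
    _ = |(linComb (latB₀ N D G) x - realVec (target P G Δ₂)) j| := by
        simp only [PiLp.sub_apply, realVec_apply]
    _ ≤ ‖linComb (latB₀ N D G) x - realVec (target P G Δ₂)‖ :=
        (Real.norm_eq_abs _).symm.le.trans (PiLp.norm_apply_le _ j)

/-- **A point of the rounded polytope is close to the centre in the lattice picture**: if all
barycentric coordinates of `x` are in `[-1, 1]` then `‖Σ xᵢ b⁰ᵢ - t‖ ≤ 2 K (N+1)`.
[cite: LenstraHW1983, §1 (second case: `τK ⊂ B(p, R)`)] -/
theorem norm_linComb_sub_target_le {P : Fin (N + 1) → Fin N → ℤ} {D : ℕ} (hD : 0 < D)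
    {G : Matrix (Fin N) (Fin N) ℤ} {Δ₂ : ℤ} (hΔ : 0 < Δ₂)
    (hG : edgeInt P * G = Δ₂ • (1 : Matrix (Fin N) (Fin N) ℤ)) (hW : (edgeInt P).det ≠ 0)
    {x : Fin N → ℝ} (hx : ∀ i, |bary (pts P D) x i| ≤ 1) :
    ‖linComb (latB₀ N D G) x - realVec (target P G Δ₂)‖ ≤ 2 * (((N : ℝ) + 1) * Δ₂) * ((N : ℝ) + 1) := by
  have hK : (0 : ℝ) < ((N : ℝ) + 1) * Δ₂ := by positivity
  have hcoord : ∀ j, |(linComb (latB₀ N D G) x - realVec (target P G Δ₂)) j| ≤ (((N : ℝ) + 1) * Δ₂) * 2 := by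
    intro j
    have h1 : (linComb (latB₀ N D G) x - realVec (target P G Δ₂)) j =
        (((N : ℝ) + 1) * Δ₂) * (tauV (pts P D) x j - 1 / ((N : ℝ) + 1)) := by
      rw [← linComb_latB₀_sub_target hD hG hW x j]; simp only [PiLp.sub_apply, realVec_apply]
    rw [h1, abs_mul, abs_of_pos hK]
    exact mul_le_mul_of_nonneg_left (abs_sub_centroid_le_two hx j) hK.le
  refine (norm_le_sqrt_mul _ (by positivity) hcoord).trans ?_
  have hsqrt : Real.sqrt N ≤ (N : ℝ) + 1 := by
    rw [Real.sqrt_le_left (by positivity)]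
    nlinarith
  calc Real.sqrt N * ((((N : ℝ) + 1) * Δ₂) * 2) ≤ ((N : ℝ) + 1) * ((((N : ℝ) + 1) * Δ₂) * 2) :=
        mul_le_mul_of_nonneg_right hsqrt (by positivity)
    _ = 2 * (((N : ℝ) + 1) * Δ₂) * ((N : ℝ) + 1) := by ring

end FixedDimILP

end Literature.Computability.Complexity
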